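import Literature.NumberTheory.Sieve.MoebiusExpSum
import Literature.NumberTheory.LFunctions.SiegelWalfiszMoebiusProofs
import HarnessLib

/-!
# Davenport's theorem `∑_{n ≤ N} μ(n) e(nθ) ≪_A N (log N)^{-A}`, and major-arc quadratic phases

Topic `Literature/NumberTheory/Sieve` (circle method). Everything in this file is PROVED
(theorems only; no definitions, no named facts).

H. Davenport, *On some infinite series involving arithmetical functions (II)*, Quart. J. Math. 8
(1937) 313–320, proved that for every `A > 0`

  `sup_θ |∑_{n ≤ N} μ(n) e(nθ)| ≪_A N (log N)^{-A}`

(the implied constant is ineffective, through Siegel's theorem); Iwaniec–Kowalski,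
*Analytic Number Theory*, Theorem 13.10 [IwaniecKowalski2004]; B. Green, T. Tao, *Quadratic
uniformity of the Möbius function*, Ann. Inst. Fourier 58 (2008), eq. (1.1) and §6
[GreenTao2008QuadraticMobius]. The tree already holds the two inputs:

* the minor arcs — the Davenport–Vaughan bound in inverse form,
  `Literature.NumberTheory.Sieve.MoebiusExpSum.exists_rat_near_of_le_norm_afExpSum`
  (if `‖∑ μ(n)e(nθ)‖ ≥ δN` then `θ` is within `C((1+log N)/δ)^{40}/N` of a rational `a/q` with
  `q ≤ C((1+log N)/δ)^{40}`);
* the major arcs — the Siegel–Walfisz theorem for `μ` in arithmetic progressions,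
  `Literature.NumberTheory.LFunctions.SiegelWalfiszMoebius_holds`.

This file supplies the deduction: on a major arc `θ = a/q + η` one splits `∑ μ(n)e(na/q)` into
residue classes mod `q` (Siegel–Walfisz, uniformly over the partial sums) and removes the smooth
factor `e(nη)` by Abel summation (`|η| N` is a power of `log N`). With Davenport's theorem in
hand, the same two devices (residue classes mod `q`, detected by additive characters, and Abel
summation against `e(ηn²)`) give the major-arc estimate for QUADRATIC phases of Green–Tao,
AIF 2008, §7 (their Proposition 7.3, "major arc quadratic phases are orthogonal to Möbius"), here
in the uniform form `‖∑_{n ≤ N} μ(n) e(αn² + βn)‖ ≤ C_A q (1 + N²|α − a/q|) N (log N)^{-A}` for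
ALL `q ≥ 1`, `a`, `α`, `β` — the major-arc half of Hua's estimate for `∑ μ(n) e(αn² + βn)`.

Main results (namespace `Literature.NumberTheory.Sieve.MoebiusExpSum`):
* `exists_moebius_progression_partial_le` — Siegel–Walfisz for `μ`, uniformly over partial sums
  `X ≤ N` and moduli `q ≤ (log N)^{A₁}`;
* `norm_afExpSum_moebius_le_log_pow` — Davenport's theorem as displayed above;
* `norm_afExpSum_moebius_le_log_pow_uniform` — the same bound `C N (log N)^{-A}` for all partial
  sums `∑_{n ≤ X} μ(n)e(nθ)`, `X ≤ N`;
* `norm_sum_moebius_quadratic_le_of_near_rat` — the major-arc bound for `e(αn² + βn)`.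
Private tools: Abel summation, orthogonality of additive characters, residue-class bounds, and
the elementary `(log x)^k ≤ (k/ε)^k x^ε`.

## References
* H. Davenport, Quart. J. Math. 8 (1937) 313–320.
* H. Iwaniec, E. Kowalski, *Analytic Number Theory*, AMS Coll. Publ. 53, Thm 13.10.
  [IwaniecKowalski2004]
* B. Green, T. Tao, Ann. Inst. Fourier 58 (2008) 1863–1935, §6 (Prop. 6.1: Davenport's bound via
  the inverse approach) and §7 (Prop. 7.3). [GreenTao2008QuadraticMobius]
* H. L. Montgomery, R. C. Vaughan, *Multiplicative Number Theory I*, §11.3. [MontgomeryVaughan2007]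
-/

noncomputable section

open Finset Real ArithmeticFunction
open scoped FourierTransform ArithmeticFunction.Moebius

namespace Literature.NumberTheory.Sieve.MoebiusExpSum

open Literature.NumberTheory.Sieve.Vinogradov
open Literature.NumberTheory.LFunctions

/-! ### Elementary tools -/

/-- `(log x)^k ≤ (k/ε)^k x^ε` for `x ≥ 1`, `k, ε > 0` (from `log x ≤ x^{ε/k}/(ε/k)`). [folklore] -/
private theorem log_rpow_le_mul_rpow {x k ε : ℝ} (hx : 1 ≤ x) (hk : 0 < k) (hε : 0 < ε) :
    Real.log x ^ k ≤ (k / ε) ^ k * x ^ ε := by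
  have hx0 : 0 ≤ x := by linarith
  have hlog : 0 ≤ Real.log x := Real.log_nonneg hx
  have h1 : Real.log x ≤ x ^ (ε / k) / (ε / k) := Real.log_le_rpow_div hx0 (by positivity)
  have h2 : x ^ (ε / k) / (ε / k) = (k / ε) * x ^ (ε / k) := by
    field_simp
  rw [h2] at h1
  calc Real.log x ^ k ≤ ((k / ε) * x ^ (ε / k)) ^ k := Real.rpow_le_rpow hlog h1 hk.le
    _ = (k / ε) ^ k * (x ^ (ε / k)) ^ k := Real.mul_rpow (by positivity) (by positivity)
    _ = (k / ε) ^ k * x ^ ε := by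
        rw [← Real.rpow_mul hx0]
        congr 2
        field_simp

/-- **Abel summation (bound form).** If all partial sums `∑_{1 ≤ n ≤ X} g(n)`, `X ≤ N`, have norm
`≤ B`, `‖ψ(N)‖ ≤ 1` and `∑_{1 ≤ n < N} ‖ψ(n+1) − ψ(n)‖ ≤ V`, then
`‖∑_{1 ≤ n ≤ N} g(n) ψ(n)‖ ≤ B (1 + V)`. [folklore] -/
private theorem norm_sum_Icc_mul_le_of_partial_sums {N : ℕ} (g ψ : ℕ → ℂ) {B V : ℝ}
    (hB : ∀ X, X ≤ N → ‖∑ n ∈ Icc 1 X, g n‖ ≤ B) (hψ : ‖ψ N‖ ≤ 1)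
    (hV : ∑ n ∈ Ico 1 N, ‖ψ (n + 1) - ψ n‖ ≤ V) :
    ‖∑ n ∈ Icc 1 N, g n * ψ n‖ ≤ B * (1 + V) := by
  set G : ℕ → ℂ := fun X => ∑ n ∈ Icc 1 X, g n with hG
  have hB0 : 0 ≤ B := le_trans (norm_nonneg _) (hB 0 (Nat.zero_le _))
  -- Abel's identity
  have habel : ∀ M : ℕ, ∑ n ∈ Icc 1 M, g n * ψ n =
      G M * ψ M - ∑ n ∈ Ico 1 M, G n * (ψ (n + 1) - ψ n) := by
    intro M
    induction M with
    | zero => simp [hG]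
    | succ M ih =>
      rw [Finset.sum_Icc_succ_top (by omega), ih]
      have hGs : G (M + 1) = G M + g (M + 1) := by
        simp only [hG]
        rw [Finset.sum_Icc_succ_top (by omega)]
      rcases Nat.eq_zero_or_pos M with rfl | hM
      · simp [hG]
      · rw [Finset.sum_Ico_succ_top hM, hGs]
        ring
  rw [habel N]
  have h1 : ‖G N * ψ N‖ ≤ B := by
    rw [norm_mul]
    calc ‖G N‖ * ‖ψ N‖ ≤ B * 1 :=
          mul_le_mul (hB N le_rfl) hψ (norm_nonneg _) hB0
      _ = B := mul_one B
  have h2 : ‖∑ n ∈ Ico 1 N, G n * (ψ (n + 1) - ψ n)‖ ≤ B * V := by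
    refine (norm_sum_le _ _).trans ?_
    calc ∑ n ∈ Ico 1 N, ‖G n * (ψ (n + 1) - ψ n)‖
        ≤ ∑ n ∈ Ico 1 N, B * ‖ψ (n + 1) - ψ n‖ := by
          refine Finset.sum_le_sum fun n hn => ?_
          rw [norm_mul]
          exact mul_le_mul_of_nonneg_right (hB n (by
            have := (Finset.mem_Ico.mp hn).2; omega)) (norm_nonneg _)
      _ = B * ∑ n ∈ Ico 1 N, ‖ψ (n + 1) - ψ n‖ := by rw [Finset.mul_sum]
      _ ≤ B * V := mul_le_mul_of_nonneg_left hV hB0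
  calc ‖G N * ψ N - ∑ n ∈ Ico 1 N, G n * (ψ (n + 1) - ψ n)‖
      ≤ ‖G N * ψ N‖ + ‖∑ n ∈ Ico 1 N, G n * (ψ (n + 1) - ψ n)‖ := norm_sub_le _ _
    _ ≤ B + B * V := add_le_add h1 h2
    _ = B * (1 + V) := by ring

/-- `‖e(x) − e(y)‖ ≤ 2π |x − y|`. [folklore] -/
private theorem norm_fourierChar_sub_fourierChar_le (x y : ℝ) :
    ‖(𝐞 x : ℂ) - 𝐞 y‖ ≤ 2 * π * |x - y| := by
  have h0 : (𝐞 x : ℂ) = 𝐞 y * 𝐞 (x - y) := by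
    rw [← Circle.coe_mul, ← AddChar.map_add_eq_mul]
    congr 2; ring
  have h : (𝐞 x : ℂ) - 𝐞 y = 𝐞 y * ((𝐞 (x - y) : ℂ) - 1) := by
    rw [mul_sub, mul_one, ← h0]
  rw [h, norm_mul, norm_fourierChar, one_mul, norm_fourierChar_sub_one]
  calc 2 * |Real.sin (π * (x - y))| ≤ 2 * |π * (x - y)| :=
        mul_le_mul_of_nonneg_left Real.abs_sin_le_abs (by norm_num)
    _ = 2 * π * |x - y| := by rw [abs_mul, abs_of_pos Real.pi_pos]; ring

/-- `e(n) = 1` for integers `n`. [folklore] -/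
private theorem fourierChar_coe_intCast (n : ℤ) : (𝐞 (n : ℝ) : ℂ) = 1 := by
  rw [Real.fourierChar_apply]
  have : ((2 * π * (n : ℝ) : ℝ) : ℂ) * Complex.I = (n : ℂ) * (2 * π * Complex.I) := by
    push_cast; ring
  rw [this]
  exact Complex.exp_int_mul_two_pi_mul_I n

/-- `e(x + n) = e(x)` for integers `n`. [folklore] -/
private theorem fourierChar_coe_add_intCast (x : ℝ) (n : ℤ) : (𝐞 (x + n) : ℂ) = 𝐞 x := by
  rw [AddChar.map_add_eq_mul, Circle.coe_mul, fourierChar_coe_intCast, mul_one]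

/-- **Orthogonality of additive characters**: for `q ≥ 1` and an integer `m`,
`∑_{s < q} e(s m / q) = q` if `q ∣ m` and `= 0` otherwise. [folklore] -/
private theorem sum_range_fourierChar_mul_div_eq {q : ℕ} (hq : 1 ≤ q) (m : ℤ) :
    ∑ s ∈ range q, (𝐞 ((s : ℝ) * m / q) : ℂ) = if (q : ℤ) ∣ m then (q : ℂ) else 0 := by
  have hq0 : (q : ℝ) ≠ 0 := by exact_mod_cast (show q ≠ 0 by omega)
  split_ifs with hdvd
  · obtain ⟨c, hc⟩ := hdvd
    have h1 : ∀ s ∈ range q, (𝐞 ((s : ℝ) * m / q) : ℂ) = 1 := by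
      intro s _
      have : (s : ℝ) * m / q = ((s * c : ℤ) : ℝ) := by
        rw [hc]; push_cast; field_simp
      rw [this]
      have h := Real.fourierChar_apply ((s * c : ℤ) : ℝ)
      rw [h]
      have : ((2 * π * ((s * c : ℤ) : ℝ) : ℝ) : ℂ) * Complex.I = ((s * c : ℤ) : ℂ) * (2 * π * Complex.I) := by
        push_cast; ring
      rw [this]
      exact Complex.exp_int_mul_two_pi_mul_I _
    rw [Finset.sum_congr rfl h1]
    simp
  · -- a nontrivial `q`-th root of unity
    set ζ : ℂ := (𝐞 ((m : ℝ) / q) : ℂ) with hζ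
    have hterm : ∀ s : ℕ, (𝐞 ((s : ℝ) * m / q) : ℂ) = ζ ^ s := by
      intro s
      rw [hζ, ← fourierChar_natCast_mul]
      congr 2
      ring
    simp_rw [hterm]
    have hζq : ζ ^ q = 1 := by
      rw [hζ, ← fourierChar_natCast_mul]
      have : (q : ℝ) * ((m : ℝ) / q) = ((m : ℤ) : ℝ) := by field_simp
      rw [this, Real.fourierChar_apply]
      have : ((2 * π * ((m : ℤ) : ℝ) : ℝ) : ℂ) * Complex.I = ((m : ℤ) : ℂ) * (2 * π * Complex.I) := by
        push_cast; ring
      rw [this]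
      exact Complex.exp_int_mul_two_pi_mul_I _
    have hζ1 : ζ ≠ 1 := by
      intro h1
      rw [hζ, Real.fourierChar_apply, Complex.exp_eq_one_iff] at h1
      obtain ⟨n, hn⟩ := h1
      have hπ : (2 * π * Complex.I : ℂ) ≠ 0 := by simp [Real.pi_ne_zero, Complex.I_ne_zero]
      have h2 : ((m : ℝ) / q : ℂ) = (n : ℂ) := by
        have hn' : ((m : ℝ) / q : ℂ) * (2 * π * Complex.I) = (n : ℂ) * (2 * π * Complex.I) := by
          rw [← hn]; push_cast; ring
        exact mul_right_cancel₀ hπ hn'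
      have h3 : (m : ℝ) / q = n := by exact_mod_cast h2
      apply hdvd
      refine ⟨n, ?_⟩
      have h4 : (m : ℝ) = q * n := by rw [← h3]; field_simp
      exact_mod_cast h4
    rw [geom_sum_eq hζ1, hζq, sub_self, zero_div]

/-! ### Sums over residue classes -/

/-- **Detecting a residue class with additive characters.** If every twisted sum
`∑_{n ∈ S} g(n) e(ns/q)`, `0 ≤ s < q`, has norm `≤ B`, then so does the sum of `g` over any residue
class `n ≡ a (mod q)` inside `S` (expand `1_{n ≡ a} = q⁻¹ ∑_s e(s(n − a)/q)`). [folklore] -/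
private theorem norm_sum_filter_zmod_le_of_twists {q : ℕ} (hq : 1 ≤ q) (S : Finset ℕ) (g : ℕ → ℂ)
    (a : ZMod q) {B : ℝ}
    (hB : ∀ s : ℕ, s < q → ‖∑ n ∈ S, g n * (𝐞 ((n : ℝ) * s / q) : ℂ)‖ ≤ B) :
    ‖∑ n ∈ S.filter (fun n : ℕ => (n : ZMod q) = a), g n‖ ≤ B := by
  haveI : NeZero q := ⟨by omega⟩
  have hq0 : (q : ℂ) ≠ 0 := by exact_mod_cast (show q ≠ 0 by omega)
  have hqr : (q : ℝ) ≠ 0 := by exact_mod_cast (show q ≠ 0 by omega)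
  set r : ℕ := a.val with hr
  have hra : (r : ZMod q) = a := by rw [hr, ZMod.natCast_zmod_val]
  -- the indicator of the class as a character sum
  have hind : ∀ n : ℕ, (if (n : ZMod q) = a then (1 : ℂ) else 0) =
      (1 / (q : ℂ)) * ∑ s ∈ range q, (𝐞 ((s : ℝ) * ((n : ℤ) - r : ℤ) / q) : ℂ) := by
    intro n
    rw [sum_range_fourierChar_mul_div_eq hq]
    have hiff : (n : ZMod q) = a ↔ (q : ℤ) ∣ ((n : ℤ) - r : ℤ) := by
      rw [← hra]
      have h1 : ((n : ℤ) : ZMod q) = ((r : ℤ) : ZMod q) ↔ (q : ℤ) ∣ (r : ℤ) - n :=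
        ZMod.intCast_eq_intCast_iff_dvd_sub _ _ _
      push_cast at h1
      rw [h1]
      constructor
      · rintro ⟨c, hc⟩; exact ⟨-c, by linarith⟩
      · rintro ⟨c, hc⟩; exact ⟨-c, by linarith⟩
    by_cases h : (n : ZMod q) = a
    · rw [if_pos h, if_pos (hiff.mp h)]; field_simp
    · rw [if_neg h, if_neg (fun h' => h (hiff.mpr h'))]; simp
  have hexp : ∑ n ∈ S.filter (fun n : ℕ => (n : ZMod q) = a), g n =
      (1 / (q : ℂ)) * ∑ s ∈ range q, (𝐞 (-((r : ℝ) * s / q)) : ℂ) *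
        ∑ n ∈ S, g n * (𝐞 ((n : ℝ) * s / q) : ℂ) := by
    rw [Finset.sum_filter]
    have h1 : ∀ n : ℕ, (if (n : ZMod q) = a then g n else 0) =
        g n * (if (n : ZMod q) = a then (1 : ℂ) else 0) := by
      intro n; split_ifs <;> simp
    simp_rw [h1, hind]
    -- both sides are the same double sum
    have he : ∀ s n : ℕ, (𝐞 ((s : ℝ) * (((n : ℤ) - r : ℤ) : ℝ) / q) : ℂ) =
        (𝐞 (-((r : ℝ) * s / q)) : ℂ) * (𝐞 ((n : ℝ) * s / q) : ℂ) := by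
      intro s n
      rw [← Circle.coe_mul, ← AddChar.map_add_eq_mul]
      congr 2; push_cast; ring
    calc ∑ n ∈ S, g n * (1 / (q : ℂ) * ∑ s ∈ range q, (𝐞 ((s : ℝ) * (((n : ℤ) - r : ℤ) : ℝ) / q) : ℂ))
        = ∑ n ∈ S, ∑ s ∈ range q, 1 / (q : ℂ) * ((𝐞 (-((r : ℝ) * s / q)) : ℂ) *
            (g n * (𝐞 ((n : ℝ) * s / q) : ℂ))) := by
          refine Finset.sum_congr rfl fun n _ => ?_
          rw [Finset.mul_sum, Finset.mul_sum]
          refine Finset.sum_congr rfl fun s _ => ?_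
          rw [he]; ring
      _ = ∑ s ∈ range q, ∑ n ∈ S, 1 / (q : ℂ) * ((𝐞 (-((r : ℝ) * s / q)) : ℂ) *
            (g n * (𝐞 ((n : ℝ) * s / q) : ℂ))) := Finset.sum_comm
      _ = 1 / (q : ℂ) * ∑ s ∈ range q, (𝐞 (-((r : ℝ) * s / q)) : ℂ) *
            ∑ n ∈ S, g n * (𝐞 ((n : ℝ) * s / q) : ℂ) := by
          rw [Finset.mul_sum]
          refine Finset.sum_congr rfl fun s _ => ?_
          rw [Finset.mul_sum, Finset.mul_sum]
  rw [hexp, norm_mul, norm_div, norm_one, Complex.norm_natCast]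
  have h3 : ‖∑ s ∈ range q, (𝐞 (-((r : ℝ) * s / q)) : ℂ) *
      ∑ n ∈ S, g n * (𝐞 ((n : ℝ) * s / q) : ℂ)‖ ≤ q * B := by
    refine (norm_sum_le _ _).trans ?_
    calc ∑ s ∈ range q, ‖(𝐞 (-((r : ℝ) * s / q)) : ℂ) * ∑ n ∈ S, g n * (𝐞 ((n : ℝ) * s / q) : ℂ)‖
        ≤ ∑ s ∈ range q, B := by
          refine Finset.sum_le_sum fun s hs => ?_
          rw [norm_mul, norm_fourierChar, one_mul]
          exact hB s (Finset.mem_range.mp hs)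
      _ = q * B := by simp
  have hq0' : (0 : ℝ) < q := by exact_mod_cast hq
  calc 1 / (q : ℝ) * ‖∑ s ∈ range q, (𝐞 (-((r : ℝ) * s / q)) : ℂ) *
        ∑ n ∈ S, g n * (𝐞 ((n : ℝ) * s / q) : ℂ)‖ ≤ 1 / (q : ℝ) * (q * B) :=
        mul_le_mul_of_nonneg_left h3 (by positivity)
    _ = B := by field_simp

/-- **Splitting into residue classes.** If `h` is `q`-periodic and `1`-bounded and the sum of `g`
over every residue class mod `q` inside `S` has norm `≤ B`, then `‖∑_{n ∈ S} g(n) h(n)‖ ≤ q B`.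
[folklore] -/
private theorem norm_sum_mul_periodic_le {q : ℕ} (hq : 1 ≤ q) (S : Finset ℕ) (g h : ℕ → ℂ)
    (hper : ∀ n m : ℕ, (n : ZMod q) = (m : ZMod q) → h n = h m) (hh : ∀ n, ‖h n‖ ≤ 1) {B : ℝ}
    (hB : ∀ a : ZMod q, ‖∑ n ∈ S.filter (fun n : ℕ => (n : ZMod q) = a), g n‖ ≤ B) :
    ‖∑ n ∈ S, g n * h n‖ ≤ q * B := by
  haveI : NeZero q := ⟨by omega⟩
  rw [← Finset.sum_fiberwise S (fun n : ℕ => (n : ZMod q)) (fun n => g n * h n)]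
  have h1 : ∀ a : ZMod q, ∑ n ∈ S.filter (fun n : ℕ => (n : ZMod q) = a), g n * h n =
      h a.val * ∑ n ∈ S.filter (fun n : ℕ => (n : ZMod q) = a), g n := by
    intro a
    rw [Finset.mul_sum]
    refine Finset.sum_congr rfl fun n hn => ?_
    have hn' : (n : ZMod q) = a := (Finset.mem_filter.mp hn).2
    rw [hper n a.val (by rw [hn', ZMod.natCast_zmod_val]), mul_comm]
  refine (norm_sum_le _ _).trans ?_
  calc ∑ a : ZMod q, ‖∑ n ∈ S.filter (fun n : ℕ => (n : ZMod q) = a), g n * h n‖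
      ≤ ∑ _a : ZMod q, B := by
        refine Finset.sum_le_sum fun a _ => ?_
        rw [h1 a, norm_mul]
        calc ‖h a.val‖ * ‖∑ n ∈ S.filter (fun n : ℕ => (n : ZMod q) = a), g n‖ ≤ 1 * B :=
              mul_le_mul (hh _) (hB a) (norm_nonneg _) zero_le_one
          _ = B := one_mul B
    _ = q * B := by simp [ZMod.card]

/-! ### Siegel–Walfisz, uniformly over partial sums -/

/-- **Siegel–Walfisz for `μ`, uniform over partial sums.** For `A₁, B > 0` there is `C > 0` with
`|∑_{n ≤ X, n ≡ a (q)} μ(n)| ≤ C N/(log N)^B` for all `N ≥ 2`, `1 ≤ q ≤ (log N)^{A₁}`, `X ≤ N`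
and all residues `a` (for `X ≤ √N` trivially, for `X > √N` by
`Literature.NumberTheory.LFunctions.SiegelWalfiszMoebius_holds` at `X`, where
`log X > (log N)/2`). [cite: MontgomeryVaughan2007, §11.3 Exercise 13(f) p. 384] -/
theorem exists_moebius_progression_partial_le (A₁ : ℝ) (hA₁ : 0 < A₁) (B : ℝ) (hB : 0 < B) :
    ∃ C : ℝ, 0 < C ∧ ∀ N : ℕ, 2 ≤ N → ∀ q : ℕ, 1 ≤ q → (q : ℝ) ≤ Real.log N ^ A₁ →
      ∀ X : ℕ, X ≤ N → ∀ a : ZMod q,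
        |∑ n ∈ (Icc 1 X).filter (fun n : ℕ => (n : ZMod q) = a), (μ n : ℝ)| ≤
          C * N / Real.log N ^ B := by
  obtain ⟨C₁, hC₁⟩ := SiegelWalfiszMoebius_holds.logPow (A := 2 * A₁) (by positivity) B
  set C : ℝ := max (max ((2 * B) ^ B) (4 ^ B)) (max C₁ 0 * 2 ^ B) with hCdef
  have hC2B : (2 * B) ^ B ≤ C := le_trans (le_max_left _ _) (le_max_left _ _)
  have hC4 : (4 : ℝ) ^ B ≤ C := le_trans (le_max_right _ _) (le_max_left _ _)
  have hCC₁ : max C₁ 0 * 2 ^ B ≤ C := le_max_right _ _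
  have hCpos : 0 < C := lt_of_lt_of_le (Real.rpow_pos_of_pos (by norm_num) B) hC4
  refine ⟨C, hCpos, fun N hN q hq hqN X hXN a => ?_⟩
  have hN0 : (0 : ℝ) < N := by exact_mod_cast (lt_of_lt_of_le (by norm_num) hN)
  have hN1 : (1 : ℝ) ≤ N := by exact_mod_cast (le_trans (by norm_num) hN)
  set L : ℝ := Real.log N with hL
  have hL2 : 1 / 2 < L := half_lt_log hN
  have hL0 : 0 < L := by linarith
  have hLB : 0 < L ^ B := Real.rpow_pos_of_pos hL0 B
  -- the trivial bound `|∑| ≤ X`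
  have htriv : |∑ n ∈ (Icc 1 X).filter (fun n : ℕ => (n : ZMod q) = a), (μ n : ℝ)| ≤ X := by
    refine (Finset.abs_sum_le_sum_abs _ _).trans ?_
    calc ∑ n ∈ (Icc 1 X).filter (fun n : ℕ => (n : ZMod q) = a), |(μ n : ℝ)|
        ≤ ∑ _n ∈ (Icc 1 X).filter (fun n : ℕ => (n : ZMod q) = a), (1 : ℝ) :=
          Finset.sum_le_sum fun n _ => by exact_mod_cast abs_moebius_le_one
      _ = #((Icc 1 X).filter (fun n : ℕ => (n : ZMod q) = a)) := by simp
      _ ≤ #(Icc 1 X) := by exact_mod_cast Finset.card_filter_le _ _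
      _ = X := by simp
  by_cases hX : ((X : ℝ)) ^ 2 ≤ N
  · -- `X ≤ √N ≤ (2B)^B N / L^B`
    have hXs : (X : ℝ) ≤ Real.sqrt N := by
      rw [← Real.sqrt_sq (Nat.cast_nonneg X)]
      exact Real.sqrt_le_sqrt hX
    have hlog : L ^ B ≤ (B / (1 / 2)) ^ B * (N : ℝ) ^ (1 / 2 : ℝ) :=
      log_rpow_le_mul_rpow hN1 hB (by norm_num)
    have hs : Real.sqrt N = (N : ℝ) ^ (1 / 2 : ℝ) := Real.sqrt_eq_rpow _
    have hss : (N : ℝ) ^ (1 / 2 : ℝ) * (N : ℝ) ^ (1 / 2 : ℝ) = N := by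
      rw [← Real.rpow_add hN0]; norm_num
    refine htriv.trans (hXs.trans ?_)
    rw [le_div_iff₀ hLB, hs]
    calc (N : ℝ) ^ (1 / 2 : ℝ) * L ^ B ≤ (N : ℝ) ^ (1 / 2 : ℝ) * ((B / (1 / 2)) ^ B * (N : ℝ) ^ (1 / 2 : ℝ)) :=
          mul_le_mul_of_nonneg_left hlog (by positivity)
      _ = (2 * B) ^ B * N := by
          rw [show B / (1 / 2) = 2 * B by ring, mul_left_comm, hss]
      _ ≤ C * N := mul_le_mul_of_nonneg_right hC2B hN0.le
  · by_cases hL4 : L < 4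
    · -- tiny `N`: `|∑| ≤ X ≤ N ≤ 4^B N / L^B`
      have hLB4 : L ^ B ≤ (4 : ℝ) ^ B := Real.rpow_le_rpow hL0.le hL4.le hB.le
      refine htriv.trans ((show (X : ℝ) ≤ N by exact_mod_cast hXN).trans ?_)
      rw [le_div_iff₀ hLB]
      calc (N : ℝ) * L ^ B ≤ N * (4 : ℝ) ^ B := mul_le_mul_of_nonneg_left hLB4 hN0.le
        _ = (4 : ℝ) ^ B * N := mul_comm _ _
        _ ≤ C * N := mul_le_mul_of_nonneg_right hC4 hN0.le
    · -- `X > √N`, `log N ≥ 4`: Siegel–Walfisz at `x = X`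
      push Not at hX hL4
      have hX2 : 2 ≤ X := by
        by_contra h
        have h1 : X ≤ 1 := by omega
        have h2 : (X : ℝ) ≤ 1 := by exact_mod_cast h1
        have h3 : (X : ℝ) ^ 2 ≤ 1 := by nlinarith [Nat.cast_nonneg (α := ℝ) X]
        linarith
      have hX0 : (0 : ℝ) < X := by exact_mod_cast (lt_of_lt_of_le (by norm_num) hX2)
      have hX2r : (2 : ℝ) ≤ X := by exact_mod_cast hX2
      have hXN' : (X : ℝ) ≤ N := by exact_mod_cast hXN
      -- `log X > L/2`
      have hlogX : L / 2 < Real.log X := by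
        have h1 : Real.log ((X : ℝ) ^ 2) = (2 : ℕ) * Real.log X := Real.log_pow (X : ℝ) 2
        have h2 : L < Real.log ((X : ℝ) ^ 2) := Real.log_lt_log hN0 hX
        rw [h1] at h2
        push_cast at h2
        linarith
      have hlogX0 : 0 < Real.log X := by linarith
      have hlogX1 : 1 ≤ Real.log X := by linarith
      -- `q ≤ (log X)^{2A₁}`
      have hqX : (q : ℝ) ≤ Real.log X ^ (2 * A₁) := by
        refine hqN.trans ?_
        have h1 : L ≤ Real.log X ^ (2 : ℝ) := by
          rw [Real.rpow_two]
          nlinarith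
        calc L ^ A₁ ≤ (Real.log X ^ (2 : ℝ)) ^ A₁ := Real.rpow_le_rpow hL0.le h1 hA₁.le
          _ = Real.log X ^ (2 * A₁) := by rw [← Real.rpow_mul hlogX0.le]
      have hsw := hC₁ (X : ℝ) hX2r q hq hqX a
      rw [Nat.floor_natCast] at hsw
      refine hsw.trans ?_
      -- `C₁ X / (log X)^B ≤ max C₁ 0 · 2^B · N / L^B`
      have hlXB : (L / 2) ^ B ≤ Real.log X ^ B :=
        Real.rpow_le_rpow (by positivity) hlogX.le hB.le
      have hlXB0 : 0 < Real.log X ^ B := Real.rpow_pos_of_pos hlogX0 B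
      have hdiv : (L / 2) ^ B = L ^ B / (2 : ℝ) ^ B := Real.div_rpow hL0.le (by norm_num) B
      have h2B : (0 : ℝ) < (2 : ℝ) ^ B := Real.rpow_pos_of_pos (by norm_num) B
      calc C₁ * X / Real.log X ^ B ≤ max C₁ 0 * N / Real.log X ^ B := by
            refine div_le_div_of_nonneg_right ?_ hlXB0.le
            exact mul_le_mul (le_max_left _ _) hXN' hX0.le (le_max_right _ _)
        _ ≤ max C₁ 0 * N / ((L / 2) ^ B) := by
            refine div_le_div_of_nonneg_left (by positivity) (by rw [hdiv]; positivity) hlXB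
        _ = max C₁ 0 * 2 ^ B * N / L ^ B := by
            rw [hdiv]; field_simp
        _ ≤ C * N / L ^ B := by
            refine div_le_div_of_nonneg_right ?_ hLB.le
            exact mul_le_mul_of_nonneg_right hCC₁ hN0.le

/-! ### Davenport's theorem -/

/-- `e(ua/q) = e(va/q)` when `q ∣ u − v`. [folklore] -/
private theorem fourierChar_intCast_mul_div_eq_of_dvd {q : ℕ} (hq : 1 ≤ q) (a : ℤ) {u v : ℤ}
    (h : (q : ℤ) ∣ u - v) :
    (𝐞 ((u : ℝ) * ((a : ℝ) / q)) : ℂ) = 𝐞 ((v : ℝ) * ((a : ℝ) / q)) := by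
  have hq0 : (q : ℝ) ≠ 0 := by exact_mod_cast (show q ≠ 0 by omega)
  obtain ⟨c, hc⟩ := h
  have h2 : (u : ℝ) * ((a : ℝ) / q) = (v : ℝ) * ((a : ℝ) / q) + ((c * a : ℤ) : ℝ) := by
    have hc' : (u : ℝ) - (v : ℝ) = (q : ℝ) * c := by exact_mod_cast hc
    push_cast
    field_simp
    linear_combination a * hc'
  rw [h2, fourierChar_coe_add_intCast]

/-- `e(na/q)` only depends on `n mod q`. [folklore] -/
private theorem fourierChar_natCast_mul_div_periodic {q : ℕ} (hq : 1 ≤ q) (a : ℤ) {n m : ℕ}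
    (h : (n : ZMod q) = (m : ZMod q)) :
    (𝐞 ((n : ℝ) * ((a : ℝ) / q)) : ℂ) = 𝐞 ((m : ℝ) * ((a : ℝ) / q)) := by
  have h1 : ((m : ℤ) : ZMod q) = ((n : ℤ) : ZMod q) := by push_cast; exact h.symm
  rw [ZMod.intCast_eq_intCast_iff_dvd_sub] at h1
  have h2 := fourierChar_intCast_mul_div_eq_of_dvd hq a h1
  push_cast at h2
  exact h2

/-- `e(n²a/q)` only depends on `n mod q`. [folklore] -/
private theorem fourierChar_natCast_sq_mul_div_periodic {q : ℕ} (hq : 1 ≤ q) (a : ℤ) {n m : ℕ}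
    (h : (n : ZMod q) = (m : ZMod q)) :
    (𝐞 ((n : ℝ) ^ 2 * ((a : ℝ) / q)) : ℂ) = 𝐞 ((m : ℝ) ^ 2 * ((a : ℝ) / q)) := by
  have h1 : ((m : ℤ) : ZMod q) = ((n : ℤ) : ZMod q) := by push_cast; exact h.symm
  rw [ZMod.intCast_eq_intCast_iff_dvd_sub] at h1
  have h1' : (q : ℤ) ∣ (n : ℤ) ^ 2 - (m : ℤ) ^ 2 := by
    have : (n : ℤ) ^ 2 - (m : ℤ) ^ 2 = ((n : ℤ) - m) * (n + m) := by ring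
    rw [this]
    exact Dvd.dvd.mul_right h1 _
  have h2 := fourierChar_intCast_mul_div_eq_of_dvd hq a h1'
  push_cast at h2
  exact h2

/-- **Davenport's theorem** (1937): for every `A > 0` there is `C` (ineffective) with
`‖∑_{n ≤ N} μ(n) e(nθ)‖ ≤ C N / (log N)^A` for all `N ≥ 2` and all real `θ`. Minor arcs: the
tree's inverse Davenport–Vaughan bound `exists_rat_near_of_le_norm_afExpSum`; major arcs:
Siegel–Walfisz for `μ` in progressions (`exists_moebius_progression_partial_le`) and Abel
summation. [cite: IwaniecKowalski2004, Theorem 13.10]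
[cite: GreenTao2008QuadraticMobius, eq. (1.1) and Proposition 6.1] -/
theorem norm_afExpSum_moebius_le_log_pow (A : ℝ) (hA : 0 < A) :
    ∃ C : ℝ, 0 < C ∧ ∀ N : ℕ, 2 ≤ N → ∀ θ : ℝ,
      ‖afExpSum (fun n => (μ n : ℝ)) N θ‖ ≤ C * N / Real.log N ^ A := by
  obtain ⟨C₀, hC₀, hinv⟩ := exists_rat_near_of_le_norm_afExpSum
  set A₁ : ℝ := 40 * (A + 1) + 1 with hA₁
  set B : ℝ := 80 * (A + 1) + A with hBdef
  obtain ⟨Csw, hCsw, hsw⟩ :=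
    exists_moebius_progression_partial_le A₁ (by positivity) B (by positivity)
  set L₀ : ℝ := max (C₀ * 3 ^ 40) 4 with hL₀
  have hL₀4 : 4 ≤ L₀ := le_max_right _ _
  have hL₀C : C₀ * 3 ^ 40 ≤ L₀ := le_max_left _ _
  set C : ℝ := max (max 1 (L₀ ^ A)) (9 * C₀ ^ 2 * 3 ^ 80 * Csw) with hCdef
  have hC1 : 1 ≤ C := le_trans (le_max_left _ _) (le_max_left _ _)
  have hCL₀ : L₀ ^ A ≤ C := le_trans (le_max_right _ _) (le_max_left _ _)
  have hCmain : 9 * C₀ ^ 2 * 3 ^ 80 * Csw ≤ C := le_max_right _ _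
  refine ⟨C, by linarith, fun N hN θ => ?_⟩
  have hN0 : (0 : ℝ) < N := by exact_mod_cast (lt_of_lt_of_le (by norm_num) hN)
  have hN1 : (1 : ℝ) ≤ N := by exact_mod_cast (le_trans (by norm_num) hN)
  set L : ℝ := Real.log N with hL
  have hL2 : 1 / 2 < L := half_lt_log hN
  have hL0 : 0 < L := by linarith
  have hLA : 0 < L ^ A := Real.rpow_pos_of_pos hL0 A
  have hLB : 0 < L ^ B := Real.rpow_pos_of_pos hL0 B
  set S := afExpSum (fun n => (μ n : ℝ)) N θ with hSdef
  have hSN : ‖S‖ ≤ N := norm_afExpSum_moebius_le_self N θ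
  by_cases hsmall : ‖S‖ < N / L ^ A
  · refine hsmall.le.trans ?_
    rw [div_le_div_iff_of_pos_right hLA]
    linarith only [mul_le_mul_of_nonneg_right hC1 hN0.le]
  push Not at hsmall
  -- the inverse theorem: `θ` is near `a/q` with `q` small
  set δ : ℝ := (L ^ A)⁻¹ with hδdef
  have hδ : 0 < δ := inv_pos.mpr hLA
  have hδN : δ * N ≤ ‖S‖ := by
    rw [hδdef]; rwa [inv_mul_eq_div]
  obtain ⟨q, a, hq1, hqle, hθ⟩ := hinv N hN θ δ hδ hδN
  set P : ℝ := C₀ * ((1 + L) / δ) ^ 40 with hPdef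
  have hq0 : (0 : ℝ) < q := by exact_mod_cast hq1
  have hP1 : 1 ≤ P := le_trans (by exact_mod_cast hq1) hqle
  have hP0 : 0 ≤ P := by linarith
  -- `P ≤ P' := C₀ 3^40 L^{40(A+1)}`
  set P' : ℝ := C₀ * 3 ^ 40 * L ^ (40 * (A + 1)) with hP'def
  have hPP' : P ≤ P' := by
    have h1 : (1 + L) / δ = (1 + L) * L ^ A := by
      rw [hδdef, div_inv_eq_mul]
    have h2 : (1 + L) * L ^ A ≤ 3 * L ^ (A + 1) := by
      rw [Real.rpow_add hL0, Real.rpow_one]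
      linarith only [mul_le_mul_of_nonneg_right (show 1 + L ≤ 3 * L by linarith only [hL2])
        hLA.le]
    have h3 : (0 : ℝ) ≤ (1 + L) / δ := by positivity
    have h4 : ((1 + L) / δ) ^ 40 ≤ (3 * L ^ (A + 1)) ^ 40 := by
      rw [h1] at h3 ⊢; exact pow_le_pow_left₀ h3 h2 40
    have h5 : (3 * L ^ (A + 1)) ^ 40 = 3 ^ 40 * L ^ (40 * (A + 1)) := by
      rw [mul_pow, ← Real.rpow_natCast (L ^ (A + 1)) 40, ← Real.rpow_mul hL0.le,
        mul_comm (A + 1) ((40 : ℕ) : ℝ)]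
      norm_num
    calc P = C₀ * ((1 + L) / δ) ^ 40 := rfl
      _ ≤ C₀ * (3 * L ^ (A + 1)) ^ 40 := mul_le_mul_of_nonneg_left h4 hC₀.le
      _ = P' := by rw [h5, hP'def, mul_assoc]
  by_cases hLL₀ : L < L₀
  · -- small `N`: trivial bound
    have h1 : L ^ A ≤ L₀ ^ A := Real.rpow_le_rpow hL0.le hLL₀.le hA.le
    refine hSN.trans ?_
    rw [le_div_iff₀ hLA]
    calc (N : ℝ) * L ^ A ≤ N * L₀ ^ A := mul_le_mul_of_nonneg_left h1 hN0.le
      _ ≤ N * C := mul_le_mul_of_nonneg_left hCL₀ hN0.le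
      _ = C * N := mul_comm _ _
  push Not at hLL₀
  have hL4 : 4 ≤ L := hL₀4.trans hLL₀
  have hL1 : 1 ≤ L := by linarith
  -- `q ≤ L^{A₁}`
  have hqA₁ : (q : ℝ) ≤ L ^ A₁ := by
    refine hqle.trans (hPP'.trans ?_)
    have h1 : C₀ * 3 ^ 40 ≤ L := hL₀C.trans hLL₀
    have h2 : (0 : ℝ) ≤ L ^ (40 * (A + 1)) := (Real.rpow_pos_of_pos hL0 _).le
    calc P' = C₀ * 3 ^ 40 * L ^ (40 * (A + 1)) := rfl
      _ ≤ L * L ^ (40 * (A + 1)) := mul_le_mul_of_nonneg_right h1 h2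
      _ = L ^ A₁ := by
          rw [hA₁, show 40 * (A + 1) + 1 = 1 + 40 * (A + 1) by ring, Real.rpow_add hL0,
            Real.rpow_one]
  have hM := hsw N hN q hq1 hqA₁
  -- partial sums of `μ(n) e(na/q)`
  set M₀ : ℝ := Csw * N / L ^ B with hM₀
  have hpart : ∀ X : ℕ, X ≤ N →
      ‖∑ n ∈ Icc 1 X, ((μ n : ℝ) : ℂ) * (𝐞 ((n : ℝ) * ((a : ℝ) / q)) : ℂ)‖ ≤ q * M₀ := by
    intro X hX
    refine norm_sum_mul_periodic_le hq1 (Icc 1 X) (fun n => ((μ n : ℝ) : ℂ))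
      (fun n => (𝐞 ((n : ℝ) * ((a : ℝ) / q)) : ℂ))
      (fun n m h => fourierChar_natCast_mul_div_periodic hq1 a h)
      (fun n => (norm_fourierChar _).le) fun b => ?_
    have h1 : ∑ n ∈ (Icc 1 X).filter (fun n : ℕ => (n : ZMod q) = b), ((μ n : ℝ) : ℂ) =
        ((∑ n ∈ (Icc 1 X).filter (fun n : ℕ => (n : ZMod q) = b), (μ n : ℝ) : ℝ) : ℂ) := by
      push_cast; rfl
    rw [h1, Complex.norm_real, Real.norm_eq_abs]
    exact hM X hX b
  -- Abel summation with `ψ(n) = e(nη)`, `η = θ − a/q`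
  set η : ℝ := θ - a / q with hηdef
  have hη : |η| ≤ P / N := hθ
  have hS_eq : S = ∑ n ∈ Icc 1 N,
      (((μ n : ℝ) : ℂ) * (𝐞 ((n : ℝ) * ((a : ℝ) / q)) : ℂ)) * (𝐞 ((n : ℝ) * η) : ℂ) := by
    rw [hSdef, afExpSum]
    refine Finset.sum_congr rfl fun n _ => ?_
    rw [mul_assoc, ← Circle.coe_mul, ← AddChar.map_add_eq_mul]
    congr 3
    rw [hηdef]; ring
  have hV : ∑ n ∈ Ico 1 N, ‖(𝐞 (((n + 1 : ℕ) : ℝ) * η) : ℂ) - 𝐞 ((n : ℝ) * η)‖ ≤ 2 * π * P := by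
    have h1 : ∀ n ∈ Ico 1 N, ‖(𝐞 (((n + 1 : ℕ) : ℝ) * η) : ℂ) - 𝐞 ((n : ℝ) * η)‖ ≤
        2 * π * (P / N) := by
      intro n _
      refine (norm_fourierChar_sub_fourierChar_le _ _).trans ?_
      have : ((n + 1 : ℕ) : ℝ) * η - (n : ℝ) * η = η := by push_cast; ring
      rw [this]
      exact mul_le_mul_of_nonneg_left hη (by positivity)
    refine (Finset.sum_le_sum h1).trans ?_
    rw [Finset.sum_const, Nat.card_Ico, nsmul_eq_mul]
    have h2 : ((N - 1 : ℕ) : ℝ) ≤ N := by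
      have : N - 1 ≤ N := Nat.sub_le N 1
      exact_mod_cast this
    calc ((N - 1 : ℕ) : ℝ) * (2 * π * (P / N)) ≤ N * (2 * π * (P / N)) :=
          mul_le_mul_of_nonneg_right h2 (by positivity)
      _ = 2 * π * P := by field_simp
  have hAbel := norm_sum_Icc_mul_le_of_partial_sums
    (fun n => ((μ n : ℝ) : ℂ) * (𝐞 ((n : ℝ) * ((a : ℝ) / q)) : ℂ))
    (fun n => (𝐞 ((n : ℝ) * η) : ℂ)) hpart (norm_fourierChar _).le hV
  rw [← hS_eq] at hAbel
  -- bookkeeping: `q M₀ (1 + 2πP) ≤ 9 P'² Csw N / L^B = 9 C₀² 3^80 Csw N / L^A`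
  have hM₀0 : 0 ≤ M₀ := by rw [hM₀]; positivity
  have h8 : (q : ℝ) * M₀ * (1 + 2 * π * P) ≤ 9 * P' ^ 2 * M₀ := by
    have hπ4 : π < 4 := Real.pi_lt_four
    have h1 : 1 + 2 * π * P ≤ 9 * P := by
      linarith only [mul_le_mul_of_nonneg_right hπ4.le hP0, hP1]
    have h2 : (q : ℝ) ≤ P' := hqle.trans hPP'
    have h3 : 9 * P ≤ 9 * P' := by linarith only [hPP']
    calc (q : ℝ) * M₀ * (1 + 2 * π * P) ≤ P' * M₀ * (9 * P') := by
          refine mul_le_mul (mul_le_mul_of_nonneg_right h2 hM₀0) (h1.trans h3) (by positivity)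
            (by positivity)
      _ = 9 * P' ^ 2 * M₀ := by ring
  have hfinal : 9 * P' ^ 2 * M₀ = 9 * C₀ ^ 2 * 3 ^ 80 * Csw * N / L ^ A := by
    have h1 : P' ^ 2 = C₀ ^ 2 * 3 ^ 80 * L ^ (80 * (A + 1)) := by
      rw [hP'def, mul_pow, mul_pow, ← Real.rpow_natCast (L ^ (40 * (A + 1))) 2,
        ← Real.rpow_mul hL0.le]
      have e : 40 * (A + 1) * ((2 : ℕ) : ℝ) = 80 * (A + 1) := by push_cast; ring
      rw [e]
      norm_num
    have h2 : L ^ B = L ^ (80 * (A + 1)) * L ^ A := by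
      rw [hBdef, Real.rpow_add hL0]
    have h3 : (0 : ℝ) < L ^ (80 * (A + 1)) := Real.rpow_pos_of_pos hL0 _
    rw [h1, hM₀, h2]
    field_simp
  calc ‖S‖ ≤ (q : ℝ) * M₀ * (1 + 2 * π * P) := hAbel
    _ ≤ 9 * P' ^ 2 * M₀ := h8
    _ = 9 * C₀ ^ 2 * 3 ^ 80 * Csw * N / L ^ A := hfinal
    _ ≤ C * N / L ^ A := by
        refine div_le_div_of_nonneg_right ?_ hLA.le
        exact mul_le_mul_of_nonneg_right hCmain hN0.le

/-- **Davenport's theorem, uniformly over partial sums**: for every `A > 0` there is `C` with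
`‖∑_{n ≤ X} μ(n) e(nθ)‖ ≤ C N / (log N)^A` for all `N ≥ 2`, `X ≤ N` and real `θ` (trivial for
`X ≤ √N`, Davenport at `X` otherwise). [cite: IwaniecKowalski2004, Theorem 13.10] -/
theorem norm_afExpSum_moebius_le_log_pow_uniform (A : ℝ) (hA : 0 < A) :
    ∃ C : ℝ, 0 < C ∧ ∀ N : ℕ, 2 ≤ N → ∀ X : ℕ, X ≤ N → ∀ θ : ℝ,
      ‖afExpSum (fun n => (μ n : ℝ)) X θ‖ ≤ C * N / Real.log N ^ A := by
  obtain ⟨C₁, hC₁, h₁⟩ := norm_afExpSum_moebius_le_log_pow A hA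
  set C : ℝ := max ((2 * A) ^ A) (C₁ * 2 ^ A) with hCdef
  have hCA : (2 * A) ^ A ≤ C := le_max_left _ _
  have hCC₁ : C₁ * 2 ^ A ≤ C := le_max_right _ _
  refine ⟨C, lt_of_lt_of_le (by positivity) hCC₁, fun N hN X hXN θ => ?_⟩
  have hN0 : (0 : ℝ) < N := by exact_mod_cast (lt_of_lt_of_le (by norm_num) hN)
  have hN1 : (1 : ℝ) ≤ N := by exact_mod_cast (le_trans (by norm_num) hN)
  set L : ℝ := Real.log N with hL
  have hL2 : 1 / 2 < L := half_lt_log hN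
  have hL0 : 0 < L := by linarith
  have hLA : 0 < L ^ A := Real.rpow_pos_of_pos hL0 A
  have htriv : ‖afExpSum (fun n => (μ n : ℝ)) X θ‖ ≤ X := norm_afExpSum_moebius_le_self X θ
  by_cases hX : ((X : ℝ)) ^ 2 ≤ N
  · have hXs : (X : ℝ) ≤ Real.sqrt N := by
      rw [← Real.sqrt_sq (Nat.cast_nonneg X)]
      exact Real.sqrt_le_sqrt hX
    have hlog : L ^ A ≤ (A / (1 / 2)) ^ A * (N : ℝ) ^ (1 / 2 : ℝ) :=
      log_rpow_le_mul_rpow hN1 hA (by norm_num)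
    have hs : Real.sqrt N = (N : ℝ) ^ (1 / 2 : ℝ) := Real.sqrt_eq_rpow _
    have hss : (N : ℝ) ^ (1 / 2 : ℝ) * (N : ℝ) ^ (1 / 2 : ℝ) = N := by
      rw [← Real.rpow_add hN0]; norm_num
    refine htriv.trans (hXs.trans ?_)
    rw [le_div_iff₀ hLA, hs]
    calc (N : ℝ) ^ (1 / 2 : ℝ) * L ^ A
        ≤ (N : ℝ) ^ (1 / 2 : ℝ) * ((A / (1 / 2)) ^ A * (N : ℝ) ^ (1 / 2 : ℝ)) :=
          mul_le_mul_of_nonneg_left hlog (by positivity)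
      _ = (2 * A) ^ A * N := by
          rw [show A / (1 / 2) = 2 * A by ring, mul_left_comm, hss]
      _ ≤ C * N := mul_le_mul_of_nonneg_right hCA hN0.le
  · push Not at hX
    have hX2 : 2 ≤ X := by
      by_contra h
      have h1 : X ≤ 1 := by omega
      have h2 : (X : ℝ) ≤ 1 := by exact_mod_cast h1
      have h3 : (X : ℝ) ^ 2 ≤ 1 := by nlinarith [Nat.cast_nonneg (α := ℝ) X]
      linarith
    have hX0 : (0 : ℝ) < X := by exact_mod_cast (lt_of_lt_of_le (by norm_num) hX2)
    have hXN' : (X : ℝ) ≤ N := by exact_mod_cast hXN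
    have hlogX : L / 2 < Real.log X := by
      have h1 : Real.log ((X : ℝ) ^ 2) = (2 : ℕ) * Real.log X := Real.log_pow (X : ℝ) 2
      have h2 : L < Real.log ((X : ℝ) ^ 2) := Real.log_lt_log hN0 hX
      rw [h1] at h2
      push_cast at h2
      linarith
    have hlogX0 : 0 < Real.log X := by linarith
    refine (h₁ X hX2 θ).trans ?_
    have hlXA : (L / 2) ^ A ≤ Real.log X ^ A :=
      Real.rpow_le_rpow (by positivity) hlogX.le hA.le
    have hlXA0 : 0 < Real.log X ^ A := Real.rpow_pos_of_pos hlogX0 A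
    have hdiv : (L / 2) ^ A = L ^ A / (2 : ℝ) ^ A := Real.div_rpow hL0.le (by norm_num) A
    have h2A : (0 : ℝ) < (2 : ℝ) ^ A := Real.rpow_pos_of_pos (by norm_num) A
    calc C₁ * X / Real.log X ^ A ≤ C₁ * N / Real.log X ^ A := by
          refine div_le_div_of_nonneg_right ?_ hlXA0.le
          exact mul_le_mul_of_nonneg_left hXN' hC₁.le
      _ ≤ C₁ * N / ((L / 2) ^ A) :=
          div_le_div_of_nonneg_left (by positivity) (by rw [hdiv]; positivity) hlXA
      _ = C₁ * 2 ^ A * N / L ^ A := by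
          rw [hdiv]; field_simp
      _ ≤ C * N / L ^ A := by
          refine div_le_div_of_nonneg_right ?_ hLA.le
          exact mul_le_mul_of_nonneg_right hCC₁ hN0.le

/-! ### Major-arc quadratic phases -/

/-- **Major-arc quadratic phases are orthogonal to the Möbius function** (Green–Tao, AIF 2008,
§7, in uniform form): for every `A > 0` there is `C` (ineffective) such that for all `N ≥ 2`,
`q ≥ 1`, `a ∈ ℤ` and real `α, β`,
`‖∑_{n ≤ N} μ(n) e(αn² + βn)‖ ≤ C q (1 + N²|α − a/q|) N / (log N)^A`.
Proof as in the source: `e(αn²) = e(an²/q) e(ηn²)`, `η = α − a/q`; `e(an²/q)` is `q`-periodic, so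
the partial sums of `μ(n) e(an²/q) e(βn)` split into `q` residue classes, each detected by additive
characters and bounded by Davenport's theorem (`norm_afExpSum_moebius_le_log_pow_uniform`); the
smooth factor `e(ηn²)` is removed by Abel summation (total variation `≤ 4π|η|N²`).
[cite: GreenTao2008QuadraticMobius, §7 Proposition 7.3 (major arc quadratic phases)] -/
theorem norm_sum_moebius_quadratic_le_of_near_rat (A : ℝ) (hA : 0 < A) :
    ∃ C : ℝ, 0 < C ∧ ∀ N : ℕ, 2 ≤ N → ∀ q : ℕ, 1 ≤ q → ∀ a : ℤ, ∀ α β : ℝ,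
      ‖∑ n ∈ Icc 1 N, ((μ n : ℝ) : ℂ) * (𝐞 (α * (n : ℝ) ^ 2 + β * n) : ℂ)‖ ≤
        C * q * (1 + (N : ℝ) ^ 2 * |α - a / q|) * N / Real.log N ^ A := by
  obtain ⟨C₁, hC₁, hD⟩ := norm_afExpSum_moebius_le_log_pow_uniform A hA
  refine ⟨4 * π * C₁, by positivity, fun N hN q hq a α β => ?_⟩
  have hN0 : (0 : ℝ) < N := by exact_mod_cast (lt_of_lt_of_le (by norm_num) hN)
  set L : ℝ := Real.log N with hL
  have hL2 : 1 / 2 < L := half_lt_log hN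
  have hL0 : 0 < L := by linarith
  have hLA : 0 < L ^ A := Real.rpow_pos_of_pos hL0 A
  have hq0 : (0 : ℝ) < q := by exact_mod_cast hq
  set η : ℝ := α - a / q with hηdef
  set D : ℝ := C₁ * N / L ^ A with hDdef
  have hD0 : 0 ≤ D := by positivity
  set g : ℕ → ℂ := fun n => ((μ n : ℝ) : ℂ) * (𝐞 ((n : ℝ) * β) : ℂ) with hgdef
  set h : ℕ → ℂ := fun n => (𝐞 ((n : ℝ) ^ 2 * ((a : ℝ) / q)) : ℂ) with hhdef
  set ψ : ℕ → ℂ := fun n => (𝐞 (η * (n : ℝ) ^ 2) : ℂ) with hψdef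
  -- the term identity
  have hterm : ∀ n : ℕ, ((μ n : ℝ) : ℂ) * (𝐞 (α * (n : ℝ) ^ 2 + β * n) : ℂ) =
      (g n * h n) * ψ n := by
    intro n
    simp only [hgdef, hhdef, hψdef]
    rw [mul_assoc, mul_assoc, ← Circle.coe_mul, ← Circle.coe_mul, ← AddChar.map_add_eq_mul,
      ← AddChar.map_add_eq_mul]
    congr 3
    rw [hηdef]; ring
  rw [Finset.sum_congr rfl fun n _ => hterm n]
  -- residue classes of `g` are bounded by Davenport's theorem
  have hfib : ∀ X : ℕ, X ≤ N → ∀ b : ZMod q,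
      ‖∑ n ∈ (Icc 1 X).filter (fun n : ℕ => (n : ZMod q) = b), g n‖ ≤ D := by
    intro X hX b
    refine norm_sum_filter_zmod_le_of_twists hq (Icc 1 X) g b fun s _ => ?_
    have h1 : ∑ n ∈ Icc 1 X, g n * (𝐞 ((n : ℝ) * s / q) : ℂ) =
        afExpSum (fun n => (μ n : ℝ)) X (β + s / q) := by
      rw [afExpSum]
      refine Finset.sum_congr rfl fun n _ => ?_
      simp only [hgdef]
      rw [mul_assoc, ← Circle.coe_mul, ← AddChar.map_add_eq_mul]
      congr 3
      ring
    rw [h1]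
    exact hD N hN X hX _
  -- partial sums of `g h`
  have hpart : ∀ X : ℕ, X ≤ N → ‖∑ n ∈ Icc 1 X, g n * h n‖ ≤ q * D := fun X hX =>
    norm_sum_mul_periodic_le hq (Icc 1 X) g h
      (fun n m hnm => fourierChar_natCast_sq_mul_div_periodic hq a hnm)
      (fun n => (norm_fourierChar _).le) (hfib X hX)
  -- total variation of `ψ`
  have hV : ∑ n ∈ Ico 1 N, ‖ψ (n + 1) - ψ n‖ ≤ 4 * π * |η| * (N : ℝ) ^ 2 := by
    have h1 : ∀ n ∈ Ico 1 N, ‖ψ (n + 1) - ψ n‖ ≤ 2 * π * |η| * (2 * N) := by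
      intro n hn
      have hnN : n < N := (Finset.mem_Ico.mp hn).2
      simp only [hψdef]
      refine (norm_fourierChar_sub_fourierChar_le _ _).trans ?_
      have e1 : η * (((n + 1 : ℕ) : ℝ)) ^ 2 - η * (n : ℝ) ^ 2 = η * (2 * n + 1) := by
        push_cast; ring
      rw [e1, abs_mul]
      have h3 : (n : ℝ) + 1 ≤ N := by exact_mod_cast hnN
      have h4 : |(2 * (n : ℝ) + 1)| ≤ 2 * N := by
        rw [abs_of_nonneg (by positivity)]
        linarith
      have h5 : 0 ≤ 2 * π * |η| := by positivity
      calc 2 * π * (|η| * |2 * (n : ℝ) + 1|) = (2 * π * |η|) * |2 * (n : ℝ) + 1| := by ring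
        _ ≤ (2 * π * |η|) * (2 * N) := mul_le_mul_of_nonneg_left h4 h5
    refine (Finset.sum_le_sum h1).trans ?_
    rw [Finset.sum_const, Nat.card_Ico, nsmul_eq_mul]
    have h2 : ((N - 1 : ℕ) : ℝ) ≤ N := by exact_mod_cast Nat.sub_le N 1
    calc ((N - 1 : ℕ) : ℝ) * (2 * π * |η| * (2 * N)) ≤ N * (2 * π * |η| * (2 * N)) :=
          mul_le_mul_of_nonneg_right h2 (by positivity)
      _ = 4 * π * |η| * (N : ℝ) ^ 2 := by ring
  have hAbel := norm_sum_Icc_mul_le_of_partial_sums (fun n => g n * h n) ψ hpart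
    (by simp only [hψdef]; exact (norm_fourierChar _).le) hV
  refine hAbel.trans ?_
  -- `q D (1 + 4π|η|N²) ≤ 4π C₁ q (1 + N²|η|) N / L^A`
  have h1 : 1 + 4 * π * |η| * (N : ℝ) ^ 2 ≤ 4 * π * (1 + (N : ℝ) ^ 2 * |η|) := by
    have : (1 : ℝ) ≤ 4 * π := by nlinarith [Real.pi_gt_three]
    nlinarith [abs_nonneg η, sq_nonneg (N : ℝ)]
  calc (q : ℝ) * D * (1 + 4 * π * |η| * (N : ℝ) ^ 2)
      ≤ (q : ℝ) * D * (4 * π * (1 + (N : ℝ) ^ 2 * |η|)) :=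
        mul_le_mul_of_nonneg_left h1 (by positivity)
    _ = 4 * π * C₁ * q * (1 + (N : ℝ) ^ 2 * |η|) * N / L ^ A := by
        rw [hDdef]; ring

end Literature.NumberTheory.Sieve.MoebiusExpSum
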